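import Summits.HodgeConjecture.HodgeConjecture.Theorems.PadicSemiregularLiftHodgeFermatVarietiesReachCoprimeThirty
import HarnessLib

/-!
# Pairs and Aoki's `σ_{p₁,A}` are reachable at their own level, for every prime `p₁ ≥ 5` — stub GP-R `stub_reach_of_pairedOrSigmaStd` of line `cancel-by-any-claim-lattice`, crux `HodgeFermatVarieties` (stmt-HodgeConjecture-1334)

Crux `HodgeFermatVarieties` (stmt-HodgeConjecture-1334), line `cancel-by-any-claim-lattice`, stub GP-R
`stub_reach_of_pairedOrSigmaStd` (programme GP of the lead, "every Hodge `(p₁+1)`-multiset at a level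
all of whose primes are `≥ p₁`, `p₁² ∤ m`, `p₁(p₁+2) ∤ m`, is pairs or `σ_{p₁,A}`"). THIS FILE: both
shapes are ℤ-reachable from the printed supply AT THEIR OWN LEVEL (`k = 1`, no level change) — the
word-for-word general-`p₁` analogue of `PadicSemiregularLiftHodgeFermatVarietiesReachCoprimeSix`
(`p₁ = 5`) and `PadicSemiregularLiftHodgeFermatVarietiesReachCoprimeThirty` (`p₁ = 7`):

* pairs `s = Q + (-Q)`, `Q` zero-free: `P :=` the pairs `{a, -a}`, `a ∈ Q` (first component of the
  supply, Aoki 1987 Thm. 1-1), `N := 0`, and `Σ_{a ∈ Q} {a, -a} = Q + (-Q)`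
  (`FermatCharacter.sum_map_pair`);
* Aoki's standard `(p₁+1)`-multiset `s = σ_{p₁,A} = {A + j (m/p₁) : j < p₁} + {-p₁A}` (`p₁ ∣ m`,
  `p₁ A ≠ 0`): `P := {s}`, `N := 0`; `s` is VERBATIM the fourth component of the supply with
  `p = p₁`, `a = A` (both spell the last point with the cast of the natural number `p₁`), `p₁` is a
  prime `≠ 2` (as `5 ≤ p₁`), and Aoki's side condition `2 < (m/p₁)/(⟨A⟩, m/p₁)` is the landed
  general-divisor lemma `two_lt_div_gcd_of_progression_ne_zero_of_dvd`: it needs `m` coprime to `6`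
  (`coprime_six_of_le_of_mem_primeFactors`: a prime `q ∣ 6` dividing `m` would satisfy
  `5 ≤ p₁ ≤ q ≤ 6`, but `5 ∤ 6` and `6` is not prime) and the zero-freeness of the `p₁` progression
  points, which are entries of the zero-free Hodge multiset `s`.

Everything here is PROVED (no `sorry`, no new definition, no new named fact); only Mathlib and the
`IsHodgeMultiset` vocabulary of `FermatShiodaCondition` (zero-freeness `hs.1.1`) enter.

References: [Aoki1987] N. Aoki, Some new algebraic cycles on Fermat varieties, J. Math. Soc. Japan 39
(1987) 385–396, Thm. 1-1 (pairs) and Thm. 2-1 (standard elements, p. 388).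
-/

-- the line's stubs all live in `…CancelByAnyClaimLattice.CoprimeSix`, a namespace not matching this file's name
set_option linter.dupNamespace false

noncomputable section

open Finset
open Literature.AlgebraicGeometry.HodgeTheory Literature.AlgebraicGeometry.HodgeTheory.FermatCharacter

namespace Summit.HodgeConjecture.HodgeConjecture.Theorems.CancelByAnyClaimLattice.CoprimeSix

/-- `Supply[M]` — the printed supply of level `M` (local notation of the line, verbatim). -/
local notation3 (prettyPrint := false) "Supply[" M "]" =>
  ({s : Multiset (ZMod M) | ∃ a : ZMod M, a ≠ 0 ∧ s = ({a, -a} : Multiset (ZMod M))} ∪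
    {s : Multiset (ZMod M) | IsHodgeMultiset s ∧ Multiset.card s = 4} ∪
    {s : Multiset (ZMod M) | IsHodgeMultiset s ∧ IsSemiDecomposable s} ∪
    {s : Multiset (ZMod M) | ∃ (p : ℕ) (a : ZMod M), p.Prime ∧ p ≠ 2 ∧ p ∣ M ∧
        2 < (M / p) / Nat.gcd (ZMod.val a) (M / p) ∧
        s = Multiset.map (fun j : ℕ => a + (j : ZMod M) * ((M / p : ℕ) : ZMod M)) (Multiset.range p) +
              {-((p : ZMod M) * a)}} : Set (Multiset (ZMod M)))

/-- `Reach[M, s]` (local notation of the line, verbatim). -/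
local notation3 (prettyPrint := false) "Reach[" M ", " s "]" =>
  ∃ P N : Multiset (Multiset (ZMod M)),
    (∀ u ∈ P, u ∈ Supply[M]) ∧ (∀ u ∈ N, u ∈ Supply[M]) ∧ s + Multiset.sum N = Multiset.sum P

/-- **A level all of whose prime factors are `≥ p₁ ≥ 5` is coprime to `6`.** If `5 ≤ p₁` and every
prime factor `q` of `m ≠ 0` satisfies `p₁ ≤ q`, then `m` is coprime to `6`: a prime `q` dividing both
`m` and `6` would satisfy `5 ≤ q ≤ 6`, but `5 ∤ 6` and `6` is not prime. (Elementary arithmetic; it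
feeds the hypothesis `m.Coprime 6` of the landed side-condition lemma
`two_lt_div_gcd_of_progression_ne_zero_of_dvd`.) [folklore] -/
theorem coprime_six_of_le_of_mem_primeFactors {p₁ m : ℕ} [NeZero m] (hp₁5 : 5 ≤ p₁)
    (hmin : ∀ q ∈ m.primeFactors, p₁ ≤ q) : m.Coprime 6 := by
  refine Nat.coprime_of_dvd fun q hq hqm hq6 ↦ ?_
  have h5 : 5 ≤ q := hp₁5.trans (hmin q (Nat.mem_primeFactors.2 ⟨hq, hqm, NeZero.ne m⟩))
  have h6 : q ≤ 6 := Nat.le_of_dvd (by norm_num) hq6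
  interval_cases q
  · exact absurd hq6 (by decide)
  · exact absurd hq (by decide)

/-- **GP-R `stub_reach_of_pairedOrSigmaStd` — both shapes of a Hodge `(p₁+1)`-multiset, `p₁ ≥ 5` a
prime, at a level all of whose primes are `≥ p₁`, are ℤ-reachable from the printed supply at their own
level.** Pairs `Q + (-Q)` (`Q` zero-free): `P :=` the pairs `{a, -a}`, `a ∈ Q` (first component of
the supply, Aoki Thm. 1-1), `N := 0` (`sum_map_pair`). Aoki's
`σ_{p₁,A} = {A + j (m/p₁) : j < p₁} + {-p₁A}` with `p₁ ∣ m`, `p₁ A ≠ 0`: `P := {s}`, `N := 0`, `s`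
being verbatim the fourth component of the supply with `p = p₁` (a prime `≠ 2` as `5 ≤ p₁`), `a = A`;
Aoki's side condition `2 < (m/p₁)/(⟨A⟩, m/p₁)` is `two_lt_div_gcd_of_progression_ne_zero_of_dvd`
(`m` coprime to `6` by `coprime_six_of_le_of_mem_primeFactors`), the `p₁` progression points being
entries of the zero-free Hodge multiset `s`. (The hypotheses `#s = p₁ + 1` and `p₁ A ≠ 0` are not
used.) [cite: Aoki1987, Thm. 1-1 and Thm. 2-1 (p. 388)] -/
theorem stub_reach_of_pairedOrSigmaStd : ∀ (p₁ : ℕ), p₁.Prime → 5 ≤ p₁ → ∀ (m : ℕ) [NeZero m], (∀ q ∈ m.primeFactors, p₁ ≤ q) → ∀ s : Multiset (ZMod m), IsHodgeMultiset s → Multiset.card s = p₁ + 1 → ((∃ Q : Multiset (ZMod m), (∀ a ∈ Q, a ≠ 0) ∧ s = Q + Q.map (fun a ↦ -a)) ∨ (p₁ ∣ m ∧ ∃ A : ZMod m, (p₁ : ZMod m) * A ≠ 0 ∧ s = (Multiset.range p₁).map (fun i : ℕ ↦ A + (i : ZMod m) * ((m / p₁ : ℕ) : ZMod m)) + {-((p₁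 : ZMod m) * A)})) → Reach[m, s] := by
  intro p₁ hp₁ hp₁5 m _ hmin s hs _ h
  rcases h with ⟨Q, hQ, hsQ⟩ | ⟨hpm, A, _, hsA⟩
  · -- pairs: `P :=` the pairs of `Q`, `N := 0`
    refine ⟨Q.map fun a ↦ ({a, -a} : Multiset (ZMod m)), 0, fun u hu ↦ ?_,
      fun u hu ↦ absurd hu (Multiset.notMem_zero u), ?_⟩
    · obtain ⟨a, ha, rfl⟩ := Multiset.mem_map.1 hu
      exact Or.inl (Or.inl (Or.inl ⟨a, hQ a ha, rfl⟩))
    · rw [Multiset.sum_zero, add_zero, sum_map_pair]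
      exact hsQ
  · -- `σ_{p₁,A}`: `P := {s}`, `N := 0`, `s` in the fourth component with `p = p₁`, `a = A`
    have hm6 : m.Coprime 6 := coprime_six_of_le_of_mem_primeFactors hp₁5 hmin
    have hA0 : ∀ j : ℕ, j < p₁ → A + (j : ZMod m) * ((m / p₁ : ℕ) : ZMod m) ≠ 0 := fun j hj ↦
      hs.1.1 _ (by
        rw [hsA]
        exact Multiset.mem_add.2 (Or.inl (Multiset.mem_map.2 ⟨j, Multiset.mem_range.2 hj, rfl⟩)))
    refine ⟨{s}, 0, fun u hu ↦ ?_, fun u hu ↦ absurd hu (Multiset.notMem_zero u), by simp⟩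
    rw [Multiset.mem_singleton] at hu
    rw [hu, hsA]
    exact Or.inr ⟨p₁, A, hp₁, by omega, hpm,
      two_lt_div_gcd_of_progression_ne_zero_of_dvd hm6 hp₁.pos hpm hA0, rfl⟩

end Summit.HodgeConjecture.HodgeConjecture.Theorems.CancelByAnyClaimLattice.CoprimeSix

end
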